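import Mathlib
import Summits.ValiantsHypothesis.ValiantsHypothesis.Theses.FreeSubtorus
import Summits.ValiantsHypothesis.ValiantsHypothesis.Theorems.RigidMinimalRepsOrbitsForceTorusAction
import Literature.Computability.AlgebraicComplexity.DetReprEquivalent

/-!
# `FreeSubtorus.OrbitDimensionBound` (crux stmt-ValiantsHypothesis-16133) — birth skeleton (BC3)

Crux (rank 2 of route-ValiantsHypothesis-FreeSubtorus), BY NAME:
`Summit.ValiantsHypothesis.ValiantsHypothesis.Theses.FreeSubtorus.OrbitDimensionBound` — for `n ≥ 3`
and every `m`: if `per_n` has an affine determinantal representation of size `m`, then it has one of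
the SAME size `m` that is equivariant with exact `GL_m × GL_m` lifts under the subtorus
`T_Λ = closure {diag(d_k e_l) : Π_k d_k^{Λ_i(k)} Π_l e_l^{Λ_i(l)} = 1 ∀ i}` of the two-sided torus
`T' = (ℂˣ)ⁿ × (ℂˣ)ⁿ`, for some `r ≤ n/2` ADMISSIBLE relations `Λ_i` (zero row-sum, zero column-sum).

## The line (= the route's own TWO-LAYER PLAN (b) for this crux, typed): invariant stabiliser in the
## categorical quotient + polystable separation

Notation.  For an `m × m` matrix `B` of affine forms write `B₀ = (constantCoeff B_ij)` and
`B_p = (coeff x_p B_ij)` (`p = (k,l)`), and for a tuple `T = (T₀, (T_p)_p)` of `δ × δ` matrices let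
`F_T(B) = det(T₀ ⊗ B₀ + Σ_p T_p ⊗ B_p)` be the BLOW-UP DETERMINANT — these generate the invariants of
`S(GL_m × GL_m) = {(g,h) : det g = det h}` acting by `B ↦ g B h⁻¹` on coefficient tuples
(Derksen–Makam 2017 = arXiv:1512.03393 Thm 1.4; Domokos–Zubkov 2001; Schofield–Van den Bergh 2001), so
"all `F_T` agree" is the typed form of "same point of the categorical quotient
`Y_m = Rep_m(per_n) // S(GL_m²)`".  A torus element `t = (d,e)` acts on tuples by `B_p ↦ d_k e_l B_p`
and FIXES THE CLASS `[B] ∈ Y_m` iff  `F_T(t⋆B) = (Πd·Πe)^δ · F_T(B)` for all `δ, T`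
(the factor `(Πd Πe)^δ` is the normalisation `det B(t·x) = (Πd Πe)·per_n`; this is verbatim the
hypothesis of the route's support item `PolystableSeparation`).

* **Stub 1 (`stub_invariantStabiliser`, the heart = the route's `OrbitDimension`):** for `n ≥ 3` and
  every affine determinantal representation `A` of `per_n` of size `m` there are a representation `B`
  of size `m` and `r ≤ n/2` admissible relations `Λ` such that EVERY `t ∈ T_Λ` fixes the class of `B`
  in `Y_m` (all normalised blow-up determinants agree).  GIT reading: the affine `T'`-variety
  `Y_m(per_n)` has a point whose `T'`-stabiliser contains an admissible subtorus of codimension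
  `≤ n/2` — e.g. a point of a CLOSED `T'`-orbit of dimension `≤ n/2` in `cl(T'·[A])`, whose stabiliser
  is the common kernel of the realised weights.  This is the per-specific number of the route; it is a
  CONSEQUENCE of the crux (exact lifts `B(t·x) = g B h⁻¹` give `F_T(t⋆B) = det g^δ det h^{-δ} F_T(B)`
  and `det g / det h = Πd Πe`), so it is no falser than the crux, and it asks for NO lift at all.
* **Stub 2 (`stub_polystableRepresentative`, GIT in the fibre):** every affine representation `B` of
  `per_n` of size `m` has a companion representation `B'` of size `m` with the SAME blow-up
  determinants (`F_T(B') = F_T(B)` for all `δ, T`: same point of `Y_m`) whose `S(GL_m²)`-orbit of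
  coefficient tuples is CLOSED (Euclidean = Zariski closure for orbits).  Known mathematics: the unique
  closed orbit in `cl(S(GL_m²)·B)` (it stays in `Rep_m(per_n)` because `det(g B h⁻¹) = det B` when
  `det g = det h`, a closed condition), and invariants are constant on orbit closures.
* **Stub 3 (`stub_closedOrbitSeparation`, Luna/Mumford separation + Derksen–Makam generation):** if
  the `S(GL_m²)`-orbit of (the tuple of) a representation `B` of `per_n` is closed, then every torus
  element `t = diag(d_k e_l)` fixing the class of `B` LIFTS EXACTLY: `B(t·x) = g · B · h⁻¹`.
  (The normalised translate `D_t · (t⋆B)`, `D_t = diag((ΠdΠe)⁻¹,1,…,1)`, has a closed orbit and the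
  same `SL_m × SL_m`-invariants as `B`; closed orbits of a reductive group are separated by invariants;
  absorb `D_t` into `g`.)  This is the route's support item `PolystableSeparation` with the polystable
  point made explicit, so a proof of either serves the other.
* **Composition (`OrbitDimensionBound_of`, sorry-free):** stub 1 gives `B, Λ`; stub 2 gives `B'` with
  the same invariants and closed orbit; for a generator `t` of `T_Λ`,
  `F_T(t⋆B') = F_{t·T}(B') = F_{t·T}(B) = F_T(t⋆B) = (ΠdΠe)^δ F_T(B) = (ΠdΠe)^δ F_T(B')`
  (`t·T = (T₀, d_k e_l T_p)`, `Matrix.smul_kronecker`), so stub 3 lifts `t` exactly on `B'`; exact lifts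
  are closed under `1, *, ⁻¹` (`lifts_one/mul/inv`, tree: `RigidMinimalRepsOrbitsForceTorusAction`),
  hence `Subgroup.closure_induction` and `isEquivariantDetRepr_iff_exists_mul_mul` give
  `IsEquivariantDetRepr T_Λ per_n B'` with the SAME `r ≤ n/2` admissible `Λ` — the crux BY NAME.

Why this is a genuine cut and not a costume.  Stub 1 replaces LIFTS (a `GL_m × GL_m`-valued cocycle on
a torus) by a STABILISER condition on finitely generated invariants — the object the route's mechanism
actually controls (closed torus orbits, weight cones, lineality); stubs 2–3 are the general GIT of the
fibre of `det` over `per_n` and hold for every polynomial in place of `per_n`.  No stub is comparable to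
the crux or to `ValiantsHypothesis` by `exact? | simpa | aesop` (BC3 probes, registrar folder
`bc/OrbitDimensionBound_probes.lean`: 6/6 FAIL; dedup `example : stub := by exact?` 3/3 FAIL).
Crux typing checklist (i) (gauge twists): stub 1 is a statement about the CLASS `[B] ∈ Y_m`, invariant
under `S(GL_m²)` and under affineness-preserving constant gauge; stubs 2–3 are existential in the
representative.  The refutations `NoTightInfinity` (stmt-5668) / `OptimalUnique` (stmt-3735/3738)
(negatives index) concern uniqueness of optimal classes and are not used.

**Disproof used.** None exists: `Cruxes/OrbitDimensionBound/` had no workfiles (no `Disproof.lean`, no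
`Negative/` lemma, no dead lines) at registration (2026-08-17).  Refuter review R1 (evidence on the item):
the decl never ties `B` to `A`, so the crux ≡ "∃ admissible `Λ`, `r ≤ n/2`: `edc_{T_Λ}(per_n) = dc(per_n)`"
up to padding, and `n = 3` holds outright (Grenet's `7 × 7` is fully `T'`-equivariant); the stubs keep
the same shape (stub 1's `B` is not tied to `A` either).  Hardest stub: `stub_invariantStabiliser`.

## Shape (skeleton audit by-name rule, as in `Cruxes/TorusBound/Lines/birth.lean`)
* `Stmt.stub_…` — the three stub statements as precise `Prop`s, named like the stubs;
* `stub_…` — the same statements as sorried theorems (the REGISTERED stubs; `sorry` occurs nowhere else);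
* `OrbitDimensionBound_of` — the composition, real proof; `OrbitDimensionBound_proof` — the crux by name
  from the stubs.  Each stub can land as
  `Theorems/FreeSubtorusOrbitDimensionBound<Stub>.lean --supports stmt-ValiantsHypothesis-16133`.
-/

namespace Summit.ValiantsHypothesis.ValiantsHypothesis.Cruxes.OrbitDimensionBound.Birth

open Matrix MvPolynomial Finset
open Literature.Computability.AlgebraicComplexity
open Summit.ValiantsHypothesis.ValiantsHypothesis.Theorems.RigidMinimalRepsOrbitsForceTorus

-- `Summit.ValiantsHypothesis.ValiantsHypothesis.…` is the tree's mandated single-conjunct layout (Sub = Summit).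
set_option linter.dupNamespace false

noncomputable section

/-! ## §1 The three stub statements as `Prop`s (named like the registered stubs) -/

/-- Statement of stub 1 (`stub_invariantStabiliser`) — **a class of `Y_m(per_n)` fixed by an
admissible half-torus.**  For `n ≥ 3` and every affine determinantal representation `A` of `per_n` of
size `m` there are an affine determinantal representation `B` of `per_n` of the same size `m`, a number
`r ≤ n/2` and `r` ADMISSIBLE relations `Λ_i ∈ ℤ^(n ⊔ n)` (zero row-sum and zero column-sum) such that
every torus element `(d,e)` satisfying the relations `Π_k d_k^{Λ_i(inl k)} Π_l e_l^{Λ_i(inr l)} = 1`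
fixes all normalised blow-up determinants of `B`:
`det(T₀ ⊗ B₀ + Σ_p d_{p.1} e_{p.2} T_p ⊗ B_p) = (Πd Πe)^δ det(T₀ ⊗ B₀ + Σ_p T_p ⊗ B_p)` for all `δ` and
all tuples `T` of `δ × δ` matrices (i.e. `T_Λ ⊆ Stab_{T'}[B]` in `Rep_m(per_n)//S(GL_m²)`).
The heart of the line (the route's `OrbitDimension`); size: open.
[cite: LandsbergRessayre2017, §2 Q2.2] [cite: arXiv:1512.03393, Thm 1.4] [cite: KempfNess1979] -/
def Stmt.stub_invariantStabiliser : Prop :=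
  ∀ n : ℕ, 3 ≤ n → ∀ (m : ℕ) (A : Matrix (Fin m) (Fin m) (MvPolynomial (Fin n × Fin n) ℂ)),
    Literature.Computability.AlgebraicComplexity.IsAffineDetRepr
        (Literature.Computability.AlgebraicComplexity.perPoly (Fin n) ℂ) A →
    ∃ (B : Matrix (Fin m) (Fin m) (MvPolynomial (Fin n × Fin n) ℂ)) (r : ℕ)
      (Λ : Fin r → (Fin n ⊕ Fin n) → ℤ),
      Literature.Computability.AlgebraicComplexity.IsAffineDetRepr
          (Literature.Computability.AlgebraicComplexity.perPoly (Fin n) ℂ) B ∧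
      r ≤ n / 2 ∧
      (∀ i, (∑ k, Λ i (Sum.inl k)) = 0 ∧ (∑ l, Λ i (Sum.inr l)) = 0) ∧
      ∀ d e : Fin n → ℂˣ,
        (∀ i, (∏ k, (d k) ^ (Λ i (Sum.inl k))) * (∏ l, (e l) ^ (Λ i (Sum.inr l))) = 1) →
        ∀ (δ : ℕ) (T : Option (Fin n × Fin n) → Matrix (Fin δ) (Fin δ) ℂ),
          (Matrix.kronecker (T none) (Matrix.of fun i j => MvPolynomial.constantCoeff (B i j)) +
              ∑ p : Fin n × Fin n, ((d p.1 : ℂ) * (e p.2 : ℂ)) •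
                Matrix.kronecker (T (some p))
                  (Matrix.of fun i j => MvPolynomial.coeff (Finsupp.single p 1) (B i j))).det =
            ((∏ k, (d k : ℂ)) * ∏ l, (e l : ℂ)) ^ δ *
              (Matrix.kronecker (T none) (Matrix.of fun i j => MvPolynomial.constantCoeff (B i j)) +
                ∑ p : Fin n × Fin n, Matrix.kronecker (T (some p))
                  (Matrix.of fun i j => MvPolynomial.coeff (Finsupp.single p 1) (B i j))).det

/-- Statement of stub 2 (`stub_polystableRepresentative`) — **a polystable companion with the same
invariants.**  For `n ≥ 3`, every affine determinantal representation `B` of `per_n` of size `m` has a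
companion affine determinantal representation `B'` of `per_n` of size `m` such that (i) the
`S(GL_m × GL_m)`-orbit `{(g B'₀ h⁻¹, (g B'_p h⁻¹)_p) : det g = det h}` of its coefficient tuple is CLOSED
(in `M_m(ℂ)^(1+n²)`, Euclidean topology), and (ii) `B'` has the same blow-up determinants as `B`:
`det(T₀ ⊗ B'₀ + Σ_p T_p ⊗ B'_p) = det(T₀ ⊗ B₀ + Σ_p T_p ⊗ B_p)` for all `δ, T` (`[B'] = [B]` in the
categorical quotient).  Known GIT (unique closed orbit in an orbit closure; invariants are constant on
closures; `det(g B h⁻¹) = det B` keeps it a representation of `per_n`); size L in Lean.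
[cite: MumfordFogartyKirwan1994, Ch. 1 §2] [cite: KempfNess1979] [cite: King1994] -/
def Stmt.stub_polystableRepresentative : Prop :=
  ∀ n : ℕ, 3 ≤ n → ∀ (m : ℕ) (B : Matrix (Fin m) (Fin m) (MvPolynomial (Fin n × Fin n) ℂ)),
    Literature.Computability.AlgebraicComplexity.IsAffineDetRepr
        (Literature.Computability.AlgebraicComplexity.perPoly (Fin n) ℂ) B →
    ∃ B' : Matrix (Fin m) (Fin m) (MvPolynomial (Fin n × Fin n) ℂ),
      Literature.Computability.AlgebraicComplexity.IsAffineDetRepr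
          (Literature.Computability.AlgebraicComplexity.perPoly (Fin n) ℂ) B' ∧
      IsClosed {X : Option (Fin n × Fin n) → Matrix (Fin m) (Fin m) ℂ |
        ∃ g h : Matrix.GeneralLinearGroup (Fin m) ℂ,
          Matrix.GeneralLinearGroup.det g = Matrix.GeneralLinearGroup.det h ∧
          X none = (g : Matrix (Fin m) (Fin m) ℂ) *
              (Matrix.of fun i j => MvPolynomial.constantCoeff (B' i j)) *
              ((h⁻¹ : Matrix.GeneralLinearGroup (Fin m) ℂ) : Matrix (Fin m) (Fin m) ℂ) ∧
          ∀ p : Fin n × Fin n, X (some p) = (g : Matrix (Fin m) (Fin m) ℂ) *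
              (Matrix.of fun i j => MvPolynomial.coeff (Finsupp.single p 1) (B' i j)) *
              ((h⁻¹ : Matrix.GeneralLinearGroup (Fin m) ℂ) : Matrix (Fin m) (Fin m) ℂ)} ∧
      ∀ (δ : ℕ) (T : Option (Fin n × Fin n) → Matrix (Fin δ) (Fin δ) ℂ),
        (Matrix.kronecker (T none) (Matrix.of fun i j => MvPolynomial.constantCoeff (B' i j)) +
            ∑ p : Fin n × Fin n, Matrix.kronecker (T (some p))
              (Matrix.of fun i j => MvPolynomial.coeff (Finsupp.single p 1) (B' i j))).det =
        (Matrix.kronecker (T none) (Matrix.of fun i j => MvPolynomial.constantCoeff (B i j)) +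
            ∑ p : Fin n × Fin n, Matrix.kronecker (T (some p))
              (Matrix.of fun i j => MvPolynomial.coeff (Finsupp.single p 1) (B i j))).det

/-- Statement of stub 3 (`stub_closedOrbitSeparation`) — **on a closed orbit, torus elements fixing
the class lift exactly.**  For `n ≥ 3` and an affine determinantal representation `B` of `per_n` of
size `m` whose `S(GL_m × GL_m)`-orbit of coefficient tuples is closed: for every torus element
`γ = diag(d_k e_l)`, if all normalised blow-up determinants of `B` are fixed by `(d,e)`
(`det(T₀ ⊗ B₀ + Σ_p d_k e_l T_p ⊗ B_p) = (Πd Πe)^δ det(T₀ ⊗ B₀ + Σ_p T_p ⊗ B_p)` for all `δ, T`), then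
`γ` lifts exactly: `B(γ·x) = g · B · h⁻¹` with `g, h ∈ GL_m(ℂ)`.  Known GIT (closed orbits of the
reductive group `S(GL_m²)` are separated by its invariants, which are generated by the blow-up
determinants: Derksen–Makam / Domokos–Zubkov / Schofield–Van den Bergh; the normalised translate
`D_t · B(γ·x)` has a closed orbit and the same invariants); this is the route's support item
`PolystableSeparation` with the polystable point made explicit; size XL in Lean (first fundamental
theorem for `SL_m × SL_m` on matrix tuples not in Mathlib).
[cite: arXiv:1512.03393, Thm 1.4] [cite: DomokosZubkov2001] [cite: SchofieldVandenBergh2001]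
[cite: MumfordFogartyKirwan1994, Ch. 1 §2] -/
def Stmt.stub_closedOrbitSeparation : Prop :=
  ∀ n : ℕ, 3 ≤ n → ∀ (m : ℕ) (B : Matrix (Fin m) (Fin m) (MvPolynomial (Fin n × Fin n) ℂ)),
    Literature.Computability.AlgebraicComplexity.IsAffineDetRepr
        (Literature.Computability.AlgebraicComplexity.perPoly (Fin n) ℂ) B →
    IsClosed {X : Option (Fin n × Fin n) → Matrix (Fin m) (Fin m) ℂ |
        ∃ g h : Matrix.GeneralLinearGroup (Fin m) ℂ,
          Matrix.GeneralLinearGroup.det g = Matrix.GeneralLinearGroup.det h ∧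
          X none = (g : Matrix (Fin m) (Fin m) ℂ) *
              (Matrix.of fun i j => MvPolynomial.constantCoeff (B i j)) *
              ((h⁻¹ : Matrix.GeneralLinearGroup (Fin m) ℂ) : Matrix (Fin m) (Fin m) ℂ) ∧
          ∀ p : Fin n × Fin n, X (some p) = (g : Matrix (Fin m) (Fin m) ℂ) *
              (Matrix.of fun i j => MvPolynomial.coeff (Finsupp.single p 1) (B i j)) *
              ((h⁻¹ : Matrix.GeneralLinearGroup (Fin m) ℂ) : Matrix (Fin m) (Fin m) ℂ)} →
    ∀ (d e : Fin n → ℂˣ) (γ : Matrix.GeneralLinearGroup (Fin n × Fin n) ℂ),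
      (γ : Matrix (Fin n × Fin n) (Fin n × Fin n) ℂ) =
          Matrix.diagonal (fun p => (d p.1 : ℂ) * (e p.2 : ℂ)) →
      (∀ (δ : ℕ) (T : Option (Fin n × Fin n) → Matrix (Fin δ) (Fin δ) ℂ),
          (Matrix.kronecker (T none) (Matrix.of fun i j => MvPolynomial.constantCoeff (B i j)) +
              ∑ p : Fin n × Fin n, ((d p.1 : ℂ) * (e p.2 : ℂ)) •
                Matrix.kronecker (T (some p))
                  (Matrix.of fun i j => MvPolynomial.coeff (Finsupp.single p 1) (B i j))).det =
            ((∏ k, (d k : ℂ)) * ∏ l, (e l : ℂ)) ^ δ *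
              (Matrix.kronecker (T none) (Matrix.of fun i j => MvPolynomial.constantCoeff (B i j)) +
                ∑ p : Fin n × Fin n, Matrix.kronecker (T (some p))
                  (Matrix.of fun i j => MvPolynomial.coeff (Finsupp.single p 1) (B i j))).det) →
      ∃ g h : Matrix.GeneralLinearGroup (Fin m) ℂ,
        Literature.Computability.AlgebraicComplexity.Matrix.linSubstEntries γ B =
          (g : Matrix (Fin m) (Fin m) ℂ).map MvPolynomial.C * B *
            ((h⁻¹ : Matrix.GeneralLinearGroup (Fin m) ℂ) : Matrix (Fin m) (Fin m) ℂ).map MvPolynomial.C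

/-! ## §2 Registered stubs (the ONLY sorries of this file) -/

/-- **Registered stub 1 = `Stmt.stub_invariantStabiliser`** (a class of `Y_m(per_n)` over a size-`m`
representation is fixed by an admissible subtorus with `r ≤ n/2` relations: all normalised blow-up
determinants agree; the heart of the line, the route's `OrbitDimension`; size: open).
[cite: LandsbergRessayre2017, §2 Q2.2] [cite: arXiv:1512.03393, Thm 1.4] -/
theorem stub_invariantStabiliser :
    ∀ n : ℕ, 3 ≤ n → ∀ (m : ℕ) (A : Matrix (Fin m) (Fin m) (MvPolynomial (Fin n × Fin n) ℂ)),
    Literature.Computability.AlgebraicComplexity.IsAffineDetRepr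
        (Literature.Computability.AlgebraicComplexity.perPoly (Fin n) ℂ) A →
    ∃ (B : Matrix (Fin m) (Fin m) (MvPolynomial (Fin n × Fin n) ℂ)) (r : ℕ)
      (Λ : Fin r → (Fin n ⊕ Fin n) → ℤ),
      Literature.Computability.AlgebraicComplexity.IsAffineDetRepr
          (Literature.Computability.AlgebraicComplexity.perPoly (Fin n) ℂ) B ∧
      r ≤ n / 2 ∧
      (∀ i, (∑ k, Λ i (Sum.inl k)) = 0 ∧ (∑ l, Λ i (Sum.inr l)) = 0) ∧
      ∀ d e : Fin n → ℂˣ,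
        (∀ i, (∏ k, (d k) ^ (Λ i (Sum.inl k))) * (∏ l, (e l) ^ (Λ i (Sum.inr l))) = 1) →
        ∀ (δ : ℕ) (T : Option (Fin n × Fin n) → Matrix (Fin δ) (Fin δ) ℂ),
          (Matrix.kronecker (T none) (Matrix.of fun i j => MvPolynomial.constantCoeff (B i j)) +
              ∑ p : Fin n × Fin n, ((d p.1 : ℂ) * (e p.2 : ℂ)) •
                Matrix.kronecker (T (some p))
                  (Matrix.of fun i j => MvPolynomial.coeff (Finsupp.single p 1) (B i j))).det =
            ((∏ k, (d k : ℂ)) * ∏ l, (e l : ℂ)) ^ δ *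
              (Matrix.kronecker (T none) (Matrix.of fun i j => MvPolynomial.constantCoeff (B i j)) +
                ∑ p : Fin n × Fin n, Matrix.kronecker (T (some p))
                  (Matrix.of fun i j => MvPolynomial.coeff (Finsupp.single p 1) (B i j))).det := by
  sorry

/-- **Registered stub 2 = `Stmt.stub_polystableRepresentative`** (every representation of `per_n` of
size `m` has a size-`m` companion with the same blow-up determinants and a CLOSED `S(GL_m²)`-orbit of
coefficient tuples; known GIT, size L). [cite: MumfordFogartyKirwan1994, Ch. 1 §2] [cite: KempfNess1979] -/
theorem stub_polystableRepresentative :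
    ∀ n : ℕ, 3 ≤ n → ∀ (m : ℕ) (B : Matrix (Fin m) (Fin m) (MvPolynomial (Fin n × Fin n) ℂ)),
    Literature.Computability.AlgebraicComplexity.IsAffineDetRepr
        (Literature.Computability.AlgebraicComplexity.perPoly (Fin n) ℂ) B →
    ∃ B' : Matrix (Fin m) (Fin m) (MvPolynomial (Fin n × Fin n) ℂ),
      Literature.Computability.AlgebraicComplexity.IsAffineDetRepr
          (Literature.Computability.AlgebraicComplexity.perPoly (Fin n) ℂ) B' ∧
      IsClosed {X : Option (Fin n × Fin n) → Matrix (Fin m) (Fin m) ℂ |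
        ∃ g h : Matrix.GeneralLinearGroup (Fin m) ℂ,
          Matrix.GeneralLinearGroup.det g = Matrix.GeneralLinearGroup.det h ∧
          X none = (g : Matrix (Fin m) (Fin m) ℂ) *
              (Matrix.of fun i j => MvPolynomial.constantCoeff (B' i j)) *
              ((h⁻¹ : Matrix.GeneralLinearGroup (Fin m) ℂ) : Matrix (Fin m) (Fin m) ℂ) ∧
          ∀ p : Fin n × Fin n, X (some p) = (g : Matrix (Fin m) (Fin m) ℂ) *
              (Matrix.of fun i j => MvPolynomial.coeff (Finsupp.single p 1) (B' i j)) *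
              ((h⁻¹ : Matrix.GeneralLinearGroup (Fin m) ℂ) : Matrix (Fin m) (Fin m) ℂ)} ∧
      ∀ (δ : ℕ) (T : Option (Fin n × Fin n) → Matrix (Fin δ) (Fin δ) ℂ),
        (Matrix.kronecker (T none) (Matrix.of fun i j => MvPolynomial.constantCoeff (B' i j)) +
            ∑ p : Fin n × Fin n, Matrix.kronecker (T (some p))
              (Matrix.of fun i j => MvPolynomial.coeff (Finsupp.single p 1) (B' i j))).det =
        (Matrix.kronecker (T none) (Matrix.of fun i j => MvPolynomial.constantCoeff (B i j)) +
            ∑ p : Fin n × Fin n, Matrix.kronecker (T (some p))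
              (Matrix.of fun i j => MvPolynomial.coeff (Finsupp.single p 1) (B i j))).det := by
  sorry

/-- **Registered stub 3 = `Stmt.stub_closedOrbitSeparation`** (on a representation of `per_n` with
closed `S(GL_m²)`-orbit, every torus element `diag(d_k e_l)` fixing all normalised blow-up determinants
lifts exactly, `B(γ·x) = g B h⁻¹`; Luna/Mumford separation + Derksen–Makam generation; size XL).
[cite: arXiv:1512.03393, Thm 1.4] [cite: DomokosZubkov2001] [cite: SchofieldVandenBergh2001] -/
theorem stub_closedOrbitSeparation :
    ∀ n : ℕ, 3 ≤ n → ∀ (m : ℕ) (B : Matrix (Fin m) (Fin m) (MvPolynomial (Fin n × Fin n) ℂ)),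
    Literature.Computability.AlgebraicComplexity.IsAffineDetRepr
        (Literature.Computability.AlgebraicComplexity.perPoly (Fin n) ℂ) B →
    IsClosed {X : Option (Fin n × Fin n) → Matrix (Fin m) (Fin m) ℂ |
        ∃ g h : Matrix.GeneralLinearGroup (Fin m) ℂ,
          Matrix.GeneralLinearGroup.det g = Matrix.GeneralLinearGroup.det h ∧
          X none = (g : Matrix (Fin m) (Fin m) ℂ) *
              (Matrix.of fun i j => MvPolynomial.constantCoeff (B i j)) *
              ((h⁻¹ : Matrix.GeneralLinearGroup (Fin m) ℂ) : Matrix (Fin m) (Fin m) ℂ) ∧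
          ∀ p : Fin n × Fin n, X (some p) = (g : Matrix (Fin m) (Fin m) ℂ) *
              (Matrix.of fun i j => MvPolynomial.coeff (Finsupp.single p 1) (B i j)) *
              ((h⁻¹ : Matrix.GeneralLinearGroup (Fin m) ℂ) : Matrix (Fin m) (Fin m) ℂ)} →
    ∀ (d e : Fin n → ℂˣ) (γ : Matrix.GeneralLinearGroup (Fin n × Fin n) ℂ),
      (γ : Matrix (Fin n × Fin n) (Fin n × Fin n) ℂ) =
          Matrix.diagonal (fun p => (d p.1 : ℂ) * (e p.2 : ℂ)) →
      (∀ (δ : ℕ) (T : Option (Fin n × Fin n) → Matrix (Fin δ) (Fin δ) ℂ),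
          (Matrix.kronecker (T none) (Matrix.of fun i j => MvPolynomial.constantCoeff (B i j)) +
              ∑ p : Fin n × Fin n, ((d p.1 : ℂ) * (e p.2 : ℂ)) •
                Matrix.kronecker (T (some p))
                  (Matrix.of fun i j => MvPolynomial.coeff (Finsupp.single p 1) (B i j))).det =
            ((∏ k, (d k : ℂ)) * ∏ l, (e l : ℂ)) ^ δ *
              (Matrix.kronecker (T none) (Matrix.of fun i j => MvPolynomial.constantCoeff (B i j)) +
                ∑ p : Fin n × Fin n, Matrix.kronecker (T (some p))
                  (Matrix.of fun i j => MvPolynomial.coeff (Finsupp.single p 1) (B i j))).det) →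
      ∃ g h : Matrix.GeneralLinearGroup (Fin m) ℂ,
        Literature.Computability.AlgebraicComplexity.Matrix.linSubstEntries γ B =
          (g : Matrix (Fin m) (Fin m) ℂ).map MvPolynomial.C * B *
            ((h⁻¹ : Matrix.GeneralLinearGroup (Fin m) ℂ) : Matrix (Fin m) (Fin m) ℂ).map MvPolynomial.C := by
  sorry

/-! ## §3 The composition (kernel-checked, sorry-free) -/

/-- **The crux from the three stubs** (real proof).  Given `n ≥ 3`, `m` and a representation `A`:
(1) stub 1 gives a representation `B` of size `m` and `r ≤ n/2` admissible relations `Λ` with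
`T_Λ ⊆ Stab[B]`; (2) stub 2 gives a companion `B'` with the same blow-up determinants and a closed
`S(GL_m²)`-orbit; for a generator `t = (d,e)` of `T_Λ` the twisted tuple `t·T = (T₀, d_k e_l T_p)`
shows `F_T(t⋆B') = F_{t·T}(B') = F_{t·T}(B) = F_T(t⋆B) = (ΠdΠe)^δ F_T(B) = (ΠdΠe)^δ F_T(B')`
(`Matrix.smul_kronecker`), so (3) stub 3 lifts `t` exactly on `B'`; exact lifts are closed under the
group operations (`lifts_one/mul/inv`), so `Subgroup.closure_induction` makes `B'` equivariant for all
of `T_Λ`, and `isEquivariantDetRepr_iff_exists_mul_mul` repackages `(P, Q)` as `(g, h⁻¹)`.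
[cite: LandsbergRessayre2017, Def. 1.3] [cite: arXiv:1512.03393, Thm 1.4] -/
theorem OrbitDimensionBound_of :
    Stmt.stub_invariantStabiliser → Stmt.stub_polystableRepresentative →
      Stmt.stub_closedOrbitSeparation →
        Summit.ValiantsHypothesis.ValiantsHypothesis.Theses.FreeSubtorus.OrbitDimensionBound := by
  intro h₁ h₂ h₃
  unfold Stmt.stub_invariantStabiliser at h₁
  unfold Stmt.stub_polystableRepresentative at h₂
  unfold Stmt.stub_closedOrbitSeparation at h₃
  unfold Summit.ValiantsHypothesis.ValiantsHypothesis.Theses.FreeSubtorus.OrbitDimensionBound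
  classical
  intro n hn m A hA
  -- (1) stub 1: a representation `B` of size `m` whose class is fixed by the admissible subtorus `T_Λ`
  obtain ⟨B, r, Λ, hB, hr, hΛ, hstab⟩ := h₁ n hn m A hA
  -- (2) stub 2: a polystable companion `B'` with the same invariants
  obtain ⟨B', hB', hclosed, hinv⟩ := h₂ n hn m B hB
  refine ⟨B', r, Λ, hr, hΛ, ?_⟩
  refine isEquivariantDetRepr_iff_exists_mul_mul.2 ⟨hB', fun γ hγ => ?_⟩
  -- (3) stub 3 on the generators + closure under the group operations
  induction hγ using Subgroup.closure_induction with
  | one => exact lifts_one B'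
  | mul x y _ _ hx hy => exact lifts_mul hx hy
  | inv x _ hx => exact lifts_inv hx
  | mem γ hγ =>
    obtain ⟨d, e, hde, hγe⟩ := hγ
    -- the class of `B'` is fixed by `(d,e)` as well: twist the test tuple `T` by `(d,e)`
    have hstabB' : ∀ (δ : ℕ) (T : Option (Fin n × Fin n) → Matrix (Fin δ) (Fin δ) ℂ),
        (Matrix.kronecker (T none) (Matrix.of fun i j => MvPolynomial.constantCoeff (B' i j)) +
            ∑ p : Fin n × Fin n, ((d p.1 : ℂ) * (e p.2 : ℂ)) •
              Matrix.kronecker (T (some p))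
                (Matrix.of fun i j => MvPolynomial.coeff (Finsupp.single p 1) (B' i j))).det =
          ((∏ k, (d k : ℂ)) * ∏ l, (e l : ℂ)) ^ δ *
            (Matrix.kronecker (T none) (Matrix.of fun i j => MvPolynomial.constantCoeff (B' i j)) +
              ∑ p : Fin n × Fin n, Matrix.kronecker (T (some p))
                (Matrix.of fun i j => MvPolynomial.coeff (Finsupp.single p 1) (B' i j))).det := by
      intro δ T
      -- the twisted tuple `t·T = (T₀, d_k e_l T_p)`
      obtain ⟨Tt, hTt₀, hTt₁⟩ : ∃ Tt : Option (Fin n × Fin n) → Matrix (Fin δ) (Fin δ) ℂ,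
          Tt none = T none ∧ ∀ p, Tt (some p) = ((d p.1 : ℂ) * (e p.2 : ℂ)) • T (some p) :=
        ⟨fun o => o.elim (T none) (fun p => ((d p.1 : ℂ) * (e p.2 : ℂ)) • T (some p)), rfl,
          fun _ => rfl⟩
      have key : ∀ M : Matrix (Fin m) (Fin m) (MvPolynomial (Fin n × Fin n) ℂ),
          Matrix.kronecker (T none) (Matrix.of fun i j => MvPolynomial.constantCoeff (M i j)) +
            ∑ p : Fin n × Fin n, ((d p.1 : ℂ) * (e p.2 : ℂ)) •
              Matrix.kronecker (T (some p))
                (Matrix.of fun i j => MvPolynomial.coeff (Finsupp.single p 1) (M i j)) =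
          Matrix.kronecker (Tt none) (Matrix.of fun i j => MvPolynomial.constantCoeff (M i j)) +
            ∑ p : Fin n × Fin n, Matrix.kronecker (Tt (some p))
              (Matrix.of fun i j => MvPolynomial.coeff (Finsupp.single p 1) (M i j)) := by
        intro M
        rw [hTt₀]
        congr 1
        refine Finset.sum_congr rfl fun p _ => ?_
        rw [hTt₁ p]
        exact (Matrix.smul_kronecker _ _ _).symm
      rw [key B', hinv δ Tt, ← key B, hstab d e hde δ T, hinv δ T]
    obtain ⟨g, h, hgh⟩ := h₃ n hn m B' hB' hclosed d e γ hγe hstabB'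
    exact ⟨g, h⁻¹, hgh⟩

/-- **THE SKELETON: the crux BY NAME, modulo exactly the three registered stubs** (the compiler
checks that the `Stmt` copies and the stub statements agree). [cite: LandsbergRessayre2017, §2] -/
theorem OrbitDimensionBound_proof :
    Summit.ValiantsHypothesis.ValiantsHypothesis.Theses.FreeSubtorus.OrbitDimensionBound :=
  OrbitDimensionBound_of stub_invariantStabiliser stub_polystableRepresentative
    stub_closedOrbitSeparation

end

end Summit.ValiantsHypothesis.ValiantsHypothesis.Cruxes.OrbitDimensionBound.Birth
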